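import Literature.NumberTheory.ConnesConsani2021.ArchDensityOfMajorant
import Literature.NumberTheory.ConnesConsani2021.SeriesRemainderRokhlinFree
import Literature.NumberTheory.LFunctions.ProlateEigenvalueDecay
import Literature.NumberTheory.ConnesConsani2021.ProlateEigenvaluePolynomialDecay
import HarnessLib

/-!
# Connes–Consani 2021, App. F Lemma F.1 (i) with a PARAMETRIC eigenvalue majorant: the tail of
# the series (98)/(sonineQ) from any (eventual) bound `|λ(n)| ≤ r(n)` — in particular from
# [Osipov 2013, Thm 33] (PROVED)

RH-FREE corpus literature (label, line 1): real analysis of the prolate series (sonineQ) of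
Prop. 5.3; nothing in this file mentions `ζ`, the critical strip or RH, and nothing here bears on
the truth of RH.  bears_on (cell rh-crit, corpus C1): apex input (B) — the App. F remainder control
behind route «ConnesConsaniSemilocal» item K2 `DensitySlope` (stmt 19308) and the (deferred) in-kernel
(E-a) certificate of K3 (stmt 19306).

Source: A. Connes, C. Consani, *Weil positivity and trace formula, the archimedean place*, Selecta
Math. (N.S.) 27 (2021) 77 = arXiv:2006.13771 [bib `ConnesConsani2021`], App. F «Issues of
convergence», Lemma F.1 (= arXiv Lemma 49), arXiv PDF p. 55 (chunk p0035:L78–L92): for `N ≥ 2`,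
`|Σ_{n>N} λ(n)(1−λ(n)²)^{-1/2}T_n(ρ)| ≤ Σ_{n>N} a(n)` (computersafe), proved in print from the bound
(rapid-decay) `|λ(n)| ≤ r_RX(n)` of §4 p. 16 ("see [Rokhlin], Theorem 14"), with
`a(n) = 4π·r_RX(n)·p(n)`.

## Why this file exists (cell rulings R64/R69)

The printed decay input (rapid-decay) = [Rokhlin–Xiao 2007, Thm 14] rests on an expansion that is
not proved in print (cell ruling R64: conjecture-class), so the landed App. F theorems for THE
prolate sequence (`lemma_49_i_prolateFun_rokhlinFree`, conditional on `CC2021_sec4_rapidDecay`) sit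
on a conjecture-class hypothesis.  The App. F ARGUMENT, however, uses of `λ(n)` only
`|λ(n)| ≤ r(n)` with `r(n) ≤ 13/200` (for `1/(1−λ²) ≤ 40000/39831`); this file runs it with an
ARBITRARY majorant `r`, so that the decay input of record — [Osipov 2013, Thm 33], PROVED in print,
typed as `Osipov2013_thm_33` with the bridge `abs_prolateEigen_le_osipovMajorant` — feeds it.
HONEST CAVEAT: with Osipov's (eventual, geometric) majorant the printed NUMBER (computersafe1)
`2.366·10⁻¹²` at `N = 10` is NOT recovered (that majorant is vacuous below Osipov-index ≈ 26); the
parametric tail is small only from larger `N` on.  The printed number remains available modulo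
(rapid-decay) (`lemma_49_ii_prolateFun_rokhlinFree`).

## What is here (all PROVED; no definition, no named fact)

Over gm-t16's minimal per-term datum `IsAppCoreDatum n ψ lam χ` (`ArchDensityOfMajorant.lean`:
prolate function + eigen-equation + (74); UNCONDITIONAL for THE prolate vectors,
`exists_isAppCoreDatum_prolateFun`):
* `IsAppCoreDatum.abs_integralTerm_le`, `IsAppCoreDatum.abs_boundaryTerms_le` — (boundAn)/(boundBn)
  made quantitative (the chains of `SeriesRemainderRokhlinFree.lean`, verbatim for the core datum);
* **`IsAppCoreDatum.abs_sonineQTerm_le_mul`** — Lemma F.1 termwise with ANY majorant: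
  `|λ| ≤ r ≤ 13/200`, `n ≥ 3`, `ρ ∈ [1,2]` ⟹ `|τ(n)T_n(ρ)| ≤ r·(4π·p(n))` (`p = remainderPoly`; with
  `r = r_RX(n)` this is the printed `a(n)`);
* `lemma_49_i_core` — (computersafe) with the majorant: `|Σ_{n>N} τ(n)T_n(ρ)| ≤ Σ_{n>N} r(n)·4πp(n)`;
* for THE prolate sequence: `abs_sonineQTerm_prolateFun_le_mul` (unconditional given the number
  `r`), `lemma_49_i_prolateFun_of_majorant`, `lemma_49_i_prolateFun_of_eventually`
  (`∀ᶠ n, |λ(n)| ≤ r(n)` and `Σ r(n)p(n) < ∞` ⟹ `∃ N, …`), `lemma_49_i_prolateFun_of_summable`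
  (from `Σ |λ(n)|n² < ∞`, the K0 chain's shape of record),
  **`lemma_49_i_prolateFun_of_osipov (h : Osipov2013_thm_33)`**, and — that shape being the tree
  theorem `summable_abs_prolateEigen_mul_sq` — the UNCONDITIONAL **`lemma_49_i_prolateFun_unconditional`**
  and `summable_sonineQTerm_prolateFun` (the series (98) converges absolutely on `[1,2]`);
* bookkeeping: `remainderPoly_le_poly`, `summable_mul_remainderPoly_of_summable_mul_pow`,
  `summable_mul_remainderPoly_of_summable_mul_sq`, `eventually_le_of_summable_mul_remainderPoly`,
  `summable_osipovMajorant_mul_remainderPoly`.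

WHAT THIS IS NOT: no discharge of any decay statement; no numerical tail value; nothing about `ζ` or
RH.
-/

noncomputable section

open Real MeasureTheory Set Filter intervalIntegral
open scoped Topology Nat

namespace Literature.NumberTheory.ConnesConsani2021

open Literature.NumberTheory.LFunctions

/-! ## App. F termwise over the minimal per-term datum, decay as a NUMBER -/

namespace IsAppCoreDatum

variable {n : ℕ} {ψ : ℝ → ℝ} {lam χ : ℝ}

/-- The endpoint bound replacing (100): for `n ≥ 3`, `ψ(1)² ≤ (27/4)(χ + 4π²)` ([Bonami–Karoui 2014];
tree `IsProlateFunction.sq_apply_one_le`; `χ > 2n(2n+1) ≥ 42 > 4π²`).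
[cite: BonamiKaroui2014, Thm. 2.1, eq. (13), Thm. 3.1] -/
theorem sq_apply_one_le (d : IsAppCoreDatum n ψ lam χ) (hn : 3 ≤ n) :
    ψ 1 ^ 2 ≤ 27 / 4 * (χ + (2 * π) ^ 2) := by
  have hn' : (3 : ℝ) ≤ n := by exact_mod_cast hn
  have hc : (2 * π) ^ 2 < χ := by nlinarith [d.eigen_gt, Real.pi_lt_d2, Real.pi_pos]
  exact d.isProlate.sq_apply_one_le d.eigen hc

/-- The endpoint bound in polynomial form: `|ψ(1)|² ≤ (27/4)(2n(2n+1) + 8π²)` for `n ≥ 3`.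
[cite: BonamiKaroui2014, Thm. 3.1] -/
theorem abs_apply_one_sq_le (d : IsAppCoreDatum n ψ lam χ) (hn : 3 ≤ n) :
    |ψ 1| ^ 2 ≤ 27 / 4 * (2 * (n : ℝ) * (2 * n + 1) + 8 * π ^ 2) := by
  rw [sq_abs]
  have h1 := d.sq_apply_one_le hn
  nlinarith [d.eigen_lt]

/-- (boundAn) made quantitative for the core datum: for `ρ ∈ [1,2]`,
`|√ρ ∫_{ρ⁻¹}^1 D_uψ · D_uη̃(ρ·)| ≤ (99/70)·(2K·(99/280)(W₀+χ))`, `K = 99π/35` (same chain as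
`IsAppFDatum.abs_integralTerm_le_F`). [cite: ConnesConsani2021, App. F eq. (boundAn), chunk p0035:L45] -/
theorem abs_integralTerm_le (d : IsAppCoreDatum n ψ lam χ) (hn : 3 ≤ n) {ρ : ℝ} (hρ1 : 1 ≤ ρ)
    (hρ2 : ρ ≤ 2) :
    |Real.sqrt ρ * ∫ x in ρ⁻¹..1, scaleDerivIn ψ x * scaleDeriv (cosTransform ψ) (ρ * x)|
      ≤ 99 / 70 * (2 * (99 * π / 35) * (99 / 280 *
        (((2 * (n : ℝ)) ^ 2 + (6 * π + 1) * (2 * n) + 3 * (2 * π + 1) ^ 2) + χ))) := by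
  obtain ⟨hf, hf', hf''c, e1, e2⟩ := hasDerivWithinAt_package d.isProlate
  have hψc : ContinuousOn ψ (Icc (-1) 1) := fun x hx ↦ (hf x hx).continuousWithinAt
  have hf'c : ContinuousOn (derivWithin ψ (Icc (-1) 1)) (Icc (-1) 1) :=
    fun x hx ↦ (hf' x hx).continuousWithinAt
  have hnorm : ∫ x in (-1 : ℝ)..1, ψ x ^ 2 = 1 := by simpa using d.isProlate.norm_one
  have hn' : (3 : ℝ) ≤ n := by exact_mod_cast hn
  have hπ := Real.pi_pos
  set W₀ : ℝ := (2 * (n : ℝ)) ^ 2 + (6 * π + 1) * (2 * n) + 3 * (2 * π + 1) ^ 2 with hW₀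
  set K : ℝ := 99 * π / 35 with hK
  have hW₀pos : 0 < W₀ := by rw [hW₀]; positivity
  have hχ4 : 4 * π ^ 2 ≤ χ := by nlinarith [d.eigen_gt, Real.pi_lt_d2]
  have hη' : ∀ y, |deriv (cosTransform ψ) y| ≤ K := fun y ↦ by
    rw [hK]; exact abs_deriv_cosTransform_le hψc hnorm y
  have hsρ : Real.sqrt ρ ≤ 99 / 70 := by
    rw [show (99 / 70 : ℝ) = Real.sqrt ((99 / 70) ^ 2) by rw [Real.sqrt_sq (by norm_num)]]
    exact Real.sqrt_le_sqrt (by nlinarith)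
  have hρ0 : 0 < ρ := by linarith
  have hρi1 : ρ⁻¹ ≤ 1 := inv_le_one_of_one_le₀ hρ1
  have hρi2 : 1 / 2 ≤ ρ⁻¹ := by rw [one_div]; exact inv_anti₀ hρ0 hρ2
  have hode := ode_Icc_of_eigen d.isProlate d.eigen
  have hwang' : ∫ x in (-1 : ℝ)..1,
      ((1 - x ^ 2) * derivWithin (derivWithin ψ (Icc (-1) 1)) (Icc (-1) 1) x) ^ 2 ≤ W₀ ^ 2 := by
    have hfull : ∫ x in (-1 : ℝ)..1,
          ((1 - x ^ 2) * derivWithin (derivWithin ψ (Icc (-1) 1)) (Icc (-1) 1) x) ^ 2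
        = ∫ x in (-1 : ℝ)..1, ((1 - x ^ 2) * deriv (deriv ψ) x) ^ 2 := by
      refine integral_congr_ae ?_
      have hae : ∀ᵐ x : ℝ, x ≠ 1 := by rw [ae_iff]; simp
      filter_upwards [hae] with x hx1 hx
      rw [uIoc_of_le (by norm_num)] at hx
      rw [e2 x ⟨hx.1, lt_of_le_of_ne hx.2 hx1⟩]
    rw [hfull, hW₀]; exact d.wang
  have hL1 := integral_abs_mul_deriv_le hψc hf'c hf''c hode hχ4 hW₀pos hwang' hnorm hρi2 hρi1
  rw [abs_mul, abs_of_nonneg (Real.sqrt_nonneg _)]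
  refine mul_le_mul hsρ ?_ (abs_nonneg _) (by norm_num)
  have hb : IntervalIntegrable (fun x ↦ 2 * K * |x * derivWithin ψ (Icc (-1) 1) x|) volume ρ⁻¹ 1 := by
    refine ((ContinuousOn.intervalIntegrable ?_).abs).const_mul _
    rw [uIcc_of_le hρi1]
    exact ContinuousOn.mul (by fun_prop) (hf'c.mono (Icc_subset_Icc (by linarith) le_rfl))
  calc |∫ x in ρ⁻¹..1, scaleDerivIn ψ x * scaleDeriv (cosTransform ψ) (ρ * x)|
      ≤ ∫ x in ρ⁻¹..1, 2 * K * |x * derivWithin ψ (Icc (-1) 1) x| := by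
        rw [← Real.norm_eq_abs]
        refine intervalIntegral.norm_integral_le_of_norm_le hρi1 ?_ hb
        refine Eventually.of_forall fun x hx ↦ ?_
        have hx0 : 0 ≤ x := le_trans (by positivity) hx.1.le
        have hρx : |ρ * x| ≤ 2 := by
          rw [abs_of_nonneg (by positivity)]; nlinarith [hx.2]
        rw [Real.norm_eq_abs, scaleDerivIn, scaleDeriv, abs_mul, abs_mul (ρ * x)]
        calc |x * derivWithin ψ (Icc (-1) 1) x| * (|ρ * x| * |deriv (cosTransform ψ) (ρ * x)|)
            ≤ |x * derivWithin ψ (Icc (-1) 1) x| * (2 * K) :=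
              mul_le_mul_of_nonneg_left (mul_le_mul hρx (hη' _) (abs_nonneg _) (by norm_num))
                (abs_nonneg _)
          _ = 2 * K * |x * derivWithin ψ (Icc (-1) 1) x| := by ring
    _ = 2 * K * ∫ x in ρ⁻¹..1, |x * derivWithin ψ (Icc (-1) 1) x| :=
        intervalIntegral.integral_const_mul _ _
    _ ≤ 2 * K * (99 / 280 * (W₀ + χ)) := mul_le_mul_of_nonneg_left hL1 (by positivity)

/-- (boundBn) made quantitative, endpoint value kept symbolic: for `ρ ∈ [1,2]` and `K = 99π/35`,
`|ρ^{-1/2}D_uψ(ρ⁻¹)η̃(1)| ≤ K·|ψ(1)|` (proportionality `λD⁺ψ = η̃′`) and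
`|ρ^{1/2}ψ(1)D_uη̃(ρ)| ≤ (99/70)·|ψ(1)|·2K` (same chain as `IsAppFDatum.abs_boundaryTerms_le_F`).
[cite: ConnesConsani2021, App. F eq. (boundBn), chunk p0035:L49–L74] -/
theorem abs_boundaryTerms_le (d : IsAppCoreDatum n ψ lam χ) {ρ : ℝ} (hρ1 : 1 ≤ ρ) (hρ2 : ρ ≤ 2) :
    |(Real.sqrt ρ)⁻¹ * scaleDerivIn ψ ρ⁻¹ * cosTransform ψ 1| ≤ 99 * π / 35 * |ψ 1| ∧
      |Real.sqrt ρ * ψ 1 * scaleDeriv (cosTransform ψ) ρ| ≤ 99 / 70 * |ψ 1| * (2 * (99 * π / 35)) := by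
  obtain ⟨hf, -, -, -, -⟩ := hasDerivWithinAt_package d.isProlate
  have hψc : ContinuousOn ψ (Icc (-1) 1) := fun x hx ↦ (hf x hx).continuousWithinAt
  have hnorm : ∫ x in (-1 : ℝ)..1, ψ x ^ 2 = 1 := by simpa using d.isProlate.norm_one
  have hπ := Real.pi_pos
  set K : ℝ := 99 * π / 35 with hK
  have hη' : ∀ y, |deriv (cosTransform ψ) y| ≤ K := fun y ↦ by
    rw [hK]; exact abs_deriv_cosTransform_le hψc hnorm y
  have hsρ : Real.sqrt ρ ≤ 99 / 70 := by
    rw [show (99 / 70 : ℝ) = Real.sqrt ((99 / 70) ^ 2) by rw [Real.sqrt_sq (by norm_num)]]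
    exact Real.sqrt_le_sqrt (by nlinarith)
  have hsρ1 : 1 ≤ Real.sqrt ρ := by
    rw [← Real.sqrt_one]; exact Real.sqrt_le_sqrt hρ1
  have hρ0 : 0 < ρ := by linarith
  have hρi1 : ρ⁻¹ ≤ 1 := inv_le_one_of_one_le₀ hρ1
  constructor
  · have hc1 : cosTransform ψ 1 = lam * ψ 1 := d.cosTransform_eq 1 (by norm_num)
    have hprop := d.lam_mul_derivWithin (y := ρ⁻¹) ⟨by linarith [inv_pos.2 hρ0], hρi1⟩
    have e : (Real.sqrt ρ)⁻¹ * scaleDerivIn ψ ρ⁻¹ * cosTransform ψ 1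
        = (Real.sqrt ρ)⁻¹ * ρ⁻¹ * deriv (cosTransform ψ) ρ⁻¹ * ψ 1 := by
      rw [hc1, scaleDerivIn, ← hprop]; ring
    rw [e, abs_mul, abs_mul, abs_mul, abs_of_pos (by positivity : (0 : ℝ) < (Real.sqrt ρ)⁻¹),
      abs_of_pos (by positivity : (0 : ℝ) < ρ⁻¹)]
    have hi1 : (Real.sqrt ρ)⁻¹ ≤ 1 := inv_le_one_of_one_le₀ hsρ1
    calc (Real.sqrt ρ)⁻¹ * ρ⁻¹ * |deriv (cosTransform ψ) ρ⁻¹| * |ψ 1| ≤ 1 * 1 * K * |ψ 1| :=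
          mul_le_mul_of_nonneg_right (mul_le_mul (mul_le_mul hi1 hρi1 (by positivity) (by norm_num))
            (hη' _) (abs_nonneg _) (by norm_num)) (abs_nonneg _)
      _ = K * |ψ 1| := by ring
  · rw [scaleDeriv, abs_mul, abs_mul, abs_mul, abs_of_nonneg (Real.sqrt_nonneg _), abs_of_pos hρ0]
    exact mul_le_mul (mul_le_mul_of_nonneg_right hsρ (abs_nonneg _))
      (mul_le_mul hρ2 (hη' ρ) (abs_nonneg _) (by norm_num)) (by positivity) (by positivity)

/-- **Lemma F.1 termwise with an ARBITRARY majorant (PROVED)**: for the core datum at index `n ≥ 3`,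
any number `r` with `|λ| ≤ r ≤ 13/200`, and `ρ ∈ [1,2]`:
`|τ(n)T_n(ρ)| ≤ r·(4π·p(n))`.  The printed proof verbatim (Schwarz, (boundWang), proportionality,
the endpoint via [Bonami–Karoui] as in `SeriesRemainderRokhlinFree.lean`, closing arithmetic
`IsAppFDatum.termwise_arith_F`), with the decay bound entering only through `|λ| ≤ r` and
`1/(1−λ²) ≤ 40000/39831`; for `r = r_RX(n)` the right-hand side is the printed `a(n)`
(`remainderTerm n = 4π·r_RX(n)·p(n)`, `rapidDecay_eq`).
[cite: ConnesConsani2021, App. F Lemma F.1 (i) (arXiv Lemma 49) proof, arXiv PDF p. 55 (chunk p0035:L78–L92)] -/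
theorem abs_sonineQTerm_le_mul (d : IsAppCoreDatum n ψ lam χ) (hn : 3 ≤ n) {r : ℝ}
    (hr : |lam| ≤ r) (hr' : r ≤ 13 / 200) {ρ : ℝ} (hρ : ρ ∈ Icc (1 : ℝ) 2) :
    |sonineQTerm ψ lam ρ| ≤ r * (4 * π * remainderPoly n) := by
  obtain ⟨hρ1, hρ2⟩ := hρ
  have hπ := Real.pi_pos
  have hS1 := d.abs_integralTerm_le hn hρ1 hρ2
  obtain ⟨hS2, hS3⟩ := d.abs_boundaryTerms_le hρ1 hρ2
  have hlamabs : |lam| ≤ 13 / 200 := hr.trans hr'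
  have hlam2 : lam ^ 2 ≤ 169 / 40000 := by
    have h0 := abs_nonneg lam
    nlinarith [sq_abs lam]
  have harith := IsAppFDatum.termwise_arith_F hn (abs_nonneg (ψ 1)) (d.abs_apply_one_sq_le hn)
  have h1l : 0 < 1 - lam ^ 2 := by linarith
  have hp0 : 0 < remainderPoly n := remainderPoly_pos n
  -- `W₀ + χ ≤ M₀`
  have hM : ((2 * (n : ℝ)) ^ 2 + (6 * π + 1) * (2 * n) + 3 * (2 * π + 1) ^ 2) + χ
      ≤ 8 * (n : ℝ) ^ 2 + (12 * π + 4) * n + 16 * π ^ 2 + 12 * π + 3 := by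
    nlinarith [d.eigen_lt]
  have hM' := mul_le_mul_of_nonneg_left hM (by positivity : (0 : ℝ) ≤ 99 * π / 35 * (9801 / 9800))
  have hlast : 4 * π * remainderPoly n * (39831 / 40000) ≤ 4 * π * remainderPoly n * (1 - lam ^ 2) :=
    mul_le_mul_of_nonneg_left (by linarith) (by positivity)
  have htri := (abs_sub (Real.sqrt ρ * (∫ x in ρ⁻¹..1, scaleDerivIn ψ x * scaleDeriv (cosTransform ψ) (ρ * x))
      + (Real.sqrt ρ)⁻¹ * scaleDerivIn ψ ρ⁻¹ * cosTransform ψ 1)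
      (Real.sqrt ρ * ψ 1 * scaleDeriv (cosTransform ψ) ρ)).trans
    (add_le_add (abs_add_le _ _) le_rfl)
  have hS : |Real.sqrt ρ * (∫ x in ρ⁻¹..1, scaleDerivIn ψ x * scaleDeriv (cosTransform ψ) (ρ * x))
        + (Real.sqrt ρ)⁻¹ * scaleDerivIn ψ ρ⁻¹ * cosTransform ψ 1
        - Real.sqrt ρ * ψ 1 * scaleDeriv (cosTransform ψ) ρ|
      ≤ 4 * π * remainderPoly n * (1 - lam ^ 2) / 2 := by
    linarith [htri, hS1, hS2, hS3, hM', harith, hlast]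
  have hr0 : 0 ≤ r := (abs_nonneg _).trans hr
  rw [sonineQTerm, abs_mul, abs_div, abs_mul, abs_two, abs_of_pos h1l]
  calc 2 * |lam| / (1 - lam ^ 2) * _
      ≤ 2 * |lam| / (1 - lam ^ 2) * (4 * π * remainderPoly n * (1 - lam ^ 2) / 2) :=
        mul_le_mul_of_nonneg_left hS (by positivity)
    _ = |lam| * (4 * π * remainderPoly n) := by field_simp
    _ ≤ r * (4 * π * remainderPoly n) := mul_le_mul_of_nonneg_right hr (by positivity)

end IsAppCoreDatum

/-! ## (computersafe) with a parametric majorant -/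

/-- **Lemma F.1 (i) = (computersafe) with an arbitrary majorant (PROVED)**: for core data beyond the
index `N ≥ 2` with `|λ(n)| ≤ r(n) ≤ 13/200` (`n > N`) and `Σ r(n)p(n) < ∞`, the tail
`Σ_{n>N} τ(n)T_n(ρ)` converges absolutely and `|Σ_{n>N} τ(n)T_n(ρ)| ≤ Σ_{n>N} r(n)·4πp(n)` for every
`ρ ∈ [1,2]`. [cite: ConnesConsani2021, App. F Lemma F.1 (i) (arXiv Lemma 49) eq. (computersafe), arXiv PDF p. 55 (chunk p0035:L78–L81)] -/
theorem lemma_49_i_core {N : ℕ} (hN : 2 ≤ N) {ψ : ℕ → ℝ → ℝ} {lam χ r : ℕ → ℝ}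
    (hd : ∀ n, N < n → IsAppCoreDatum n (ψ n) (lam n) (χ n))
    (hr : ∀ n, N < n → |lam n| ≤ r n) (hr' : ∀ n, N < n → r n ≤ 13 / 200)
    (hs : Summable (fun n ↦ r n * remainderPoly n)) {ρ : ℝ} (hρ : ρ ∈ Icc (1 : ℝ) 2) :
    Summable (fun k : ℕ ↦ sonineQTerm (ψ (k + (N + 1))) (lam (k + (N + 1))) ρ) ∧
      |∑' k : ℕ, sonineQTerm (ψ (k + (N + 1))) (lam (k + (N + 1))) ρ|
        ≤ ∑' k : ℕ, r (k + (N + 1)) * (4 * π * remainderPoly (k + (N + 1))) := by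
  have hb : ∀ k : ℕ, ‖sonineQTerm (ψ (k + (N + 1))) (lam (k + (N + 1))) ρ‖
      ≤ r (k + (N + 1)) * (4 * π * remainderPoly (k + (N + 1))) := fun k ↦ by
    rw [Real.norm_eq_abs]
    exact (hd _ (by omega)).abs_sonineQTerm_le_mul (by omega) (hr _ (by omega))
      (hr' _ (by omega)) hρ
  have hs' : Summable (fun k : ℕ ↦ r (k + (N + 1)) * (4 * π * remainderPoly (k + (N + 1)))) := by
    have h := (summable_nat_add_iff (f := fun n ↦ 4 * π * (r n * remainderPoly n)) (N + 1)).2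
      (hs.mul_left (4 * π))
    exact h.congr fun k ↦ by ring
  refine ⟨Summable.of_norm_bounded hs' hb, ?_⟩
  rw [← Real.norm_eq_abs]
  exact tsum_of_norm_bounded hs'.hasSum hb

/-! ## Bookkeeping on majorants -/

/-- `p(n) ≤ 16n² + (32+24π)n + (8+24π+32π²)` (`√(4n+1) ≤ 4n+1`, `4+√2 ≤ 6`).
[cite: ConnesConsani2021, App. F Lemma F.1 (i) (arXiv Lemma 49), arXiv PDF p. 55 (chunk p0035:L81)] -/
theorem remainderPoly_le_poly (n : ℕ) :
    remainderPoly n ≤ 16 * (n : ℝ) ^ 2 + (32 + 24 * π) * n + (8 + 24 * π + 32 * π ^ 2) := by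
  have hn : (0 : ℝ) ≤ n := Nat.cast_nonneg n
  have hπ := Real.pi_pos
  have hs : Real.sqrt (4 * n + 1) ≤ 4 * n + 1 := by
    calc Real.sqrt (4 * n + 1) ≤ Real.sqrt ((4 * n + 1) ^ 2) := Real.sqrt_le_sqrt (by nlinarith)
      _ = 4 * n + 1 := Real.sqrt_sq (by positivity)
  have h2 : Real.sqrt 2 ≤ 2 := by
    calc Real.sqrt 2 ≤ Real.sqrt (2 ^ 2) := Real.sqrt_le_sqrt (by norm_num)
      _ = 2 := Real.sqrt_sq (by norm_num)
  have h46 : 4 + Real.sqrt 2 ≤ 6 := by linarith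
  have hprod : (4 + Real.sqrt 2) * Real.sqrt (4 * n + 1) ≤ 6 * (4 * n + 1) :=
    mul_le_mul h46 hs (Real.sqrt_nonneg _) (by norm_num)
  unfold remainderPoly
  linarith

/-- If `r ≥ 0` and `Σ r(n)`, `Σ r(n)n`, `Σ r(n)n²` converge then `Σ r(n)p(n)` converges.
[cite: ConnesConsani2021, App. F Lemma F.1 (i) (arXiv Lemma 49) eq. (computersafe)] -/
theorem summable_mul_remainderPoly_of_summable_mul_pow {r : ℕ → ℝ} (hr0 : ∀ n, 0 ≤ r n)
    (h0 : Summable r) (h1 : Summable (fun n ↦ r n * n)) (h2 : Summable (fun n ↦ r n * (n : ℝ) ^ 2)) :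
    Summable (fun n ↦ r n * remainderPoly n) := by
  have hB : Summable (fun n ↦ 16 * (r n * (n : ℝ) ^ 2) + (32 + 24 * π) * (r n * n)
      + (8 + 24 * π + 32 * π ^ 2) * r n) :=
    ((h2.mul_left 16).add (h1.mul_left _)).add (h0.mul_left _)
  refine Summable.of_nonneg_of_le (fun n ↦ mul_nonneg (hr0 n) (remainderPoly_pos n).le)
    (fun n ↦ ?_) hB
  have h := mul_le_mul_of_nonneg_left (remainderPoly_le_poly n) (hr0 n)
  have e : r n * (16 * (n : ℝ) ^ 2 + (32 + 24 * π) * n + (8 + 24 * π + 32 * π ^ 2))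
      = 16 * (r n * (n : ℝ) ^ 2) + (32 + 24 * π) * (r n * n) + (8 + 24 * π + 32 * π ^ 2) * r n := by
    ring
  linarith

/-- If `Σ r(n)p(n)` converges then `r(n) ≤ ε` eventually (`p(n) ≥ 300`).
[cite: ConnesConsani2021, App. F Lemma F.1 (i) (arXiv Lemma 49), arXiv PDF p. 55 (chunk p0035:L81)] -/
theorem eventually_le_of_summable_mul_remainderPoly {r : ℕ → ℝ}
    (hs : Summable (fun n ↦ r n * remainderPoly n)) {ε : ℝ} (hε : 0 < ε) :
    ∀ᶠ n in atTop, r n ≤ ε := by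
  have ht : Tendsto r atTop (𝓝 0) := by
    refine squeeze_zero_norm (a := fun n ↦ ‖r n * remainderPoly n‖) (fun n ↦ ?_) ?_
    · rw [norm_mul, Real.norm_of_nonneg (remainderPoly_pos n).le]
      have h1 : 1 ≤ remainderPoly n := by
        have := (remainderPoly_lower n).1; nlinarith [sq_nonneg (n : ℝ)]
      calc ‖r n‖ = ‖r n‖ * 1 := (mul_one _).symm
        _ ≤ ‖r n‖ * remainderPoly n := mul_le_mul_of_nonneg_left h1 (norm_nonneg _)
    · simpa using hs.tendsto_atTop_zero.norm
  exact ht.eventually (eventually_le_nhds hε)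

/-- If `r ≥ 0` and `Σ r(n)n² < ∞` then `Σ r(n)p(n) < ∞` (the shape of record of the K0 chain,
`ArchDensityOfMajorant.lean`'s `hdec`, transported to App. F's weight `p`).
[cite: ConnesConsani2021, App. F Lemma F.1 (i) (arXiv Lemma 49) eq. (computersafe)] -/
theorem summable_mul_remainderPoly_of_summable_mul_sq {r : ℕ → ℝ} (hr0 : ∀ n, 0 ≤ r n)
    (h2 : Summable (fun n ↦ r n * (n : ℝ) ^ 2)) : Summable (fun n ↦ r n * remainderPoly n) := by
  have hk : ∀ k ≤ 2, Summable (fun n ↦ r n * (n : ℝ) ^ k) := by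
    intro k hk
    refine Summable.of_norm_bounded_eventually_nat h2 ?_
    filter_upwards [eventually_ge_atTop 1] with n hn
    have hn' : (1 : ℝ) ≤ n := by exact_mod_cast hn
    rw [Real.norm_of_nonneg (mul_nonneg (hr0 n) (by positivity))]
    exact mul_le_mul_of_nonneg_left (pow_le_pow_right₀ hn' hk) (hr0 n)
  exact summable_mul_remainderPoly_of_summable_mul_pow hr0 ((hk 0 (by norm_num)).congr fun n ↦ by simp)
    ((hk 1 (by norm_num)).congr fun n ↦ by simp) (hk 2 le_rfl)

/-- `Σ_n r_Os(n)·p(n) < ∞` for Osipov's geometric majorant `osipovMajorant`.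
[cite: Osipov2013, Thm. 33; ConnesConsani2021, App. F Lemma F.1 (i) (arXiv Lemma 49)] -/
theorem summable_osipovMajorant_mul_remainderPoly :
    Summable (fun n ↦ osipovMajorant n * remainderPoly n) := by
  refine summable_mul_remainderPoly_of_summable_mul_pow (fun n ↦ (osipovMajorant_pos n).le)
    ((summable_osipovMajorant_mul_pow 0).congr fun n ↦ by simp)
    ((summable_osipovMajorant_mul_pow 1).congr fun n ↦ by simp)
    (summable_osipovMajorant_mul_pow 2)

/-! ## THE prolate sequence -/

/-- **Lemma F.1 termwise for THE series with the decay as a number (PROVED, unconditional given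
`r`)**: for `n ≥ 3`, `ρ ∈ [1,2]` and any `r` with `|λ(n)| ≤ r ≤ 13/200`,
`|τ(n)T_n(ρ)| ≤ r·(4π·p(n))` — the per-term datum of THE prolate vectors being unconditional
(`exists_isAppCoreDatum_prolateFun`).
[cite: ConnesConsani2021, App. F Lemma F.1 (i) (arXiv Lemma 49), arXiv PDF p. 55 (chunk p0035:L87–L92)] -/
theorem abs_sonineQTerm_prolateFun_le_mul {n : ℕ} (hn : 3 ≤ n) {r : ℝ}
    (hr : |prolateEigen n| ≤ r) (hr' : r ≤ 13 / 200) {ρ : ℝ} (hρ : ρ ∈ Icc (1 : ℝ) 2) :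
    |sonineQTerm (prolateFun n) (prolateEigen n) ρ| ≤ r * (4 * π * remainderPoly n) := by
  obtain ⟨χ, d⟩ := exists_isAppCoreDatum_prolateFun n
  exact d.abs_sonineQTerm_le_mul hn hr hr' hρ

/-- **(computersafe) for THE series with a parametric majorant (PROVED)**: if `|λ(n)| ≤ r(n) ≤ 13/200`
for `n > N ≥ 2` and `Σ r(n)p(n) < ∞`, then for every `ρ ∈ [1,2]` the tail `Σ_{n>N} τ(n)T_n(ρ)`
converges absolutely and `|Σ_{n>N} τ(n)T_n(ρ)| ≤ Σ_{n>N} r(n)·4πp(n)`.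
[cite: ConnesConsani2021, App. F Lemma F.1 (i) (arXiv Lemma 49) eq. (computersafe), arXiv PDF p. 55 (chunk p0035:L78–L81)] -/
theorem lemma_49_i_prolateFun_of_majorant {N : ℕ} (hN : 2 ≤ N) {r : ℕ → ℝ}
    (hr : ∀ n, N < n → |prolateEigen n| ≤ r n) (hr' : ∀ n, N < n → r n ≤ 13 / 200)
    (hs : Summable (fun n ↦ r n * remainderPoly n)) {ρ : ℝ} (hρ : ρ ∈ Icc (1 : ℝ) 2) :
    Summable (fun k : ℕ ↦ sonineQTerm (prolateFun (k + (N + 1))) (prolateEigen (k + (N + 1))) ρ) ∧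
      |∑' k : ℕ, sonineQTerm (prolateFun (k + (N + 1))) (prolateEigen (k + (N + 1))) ρ|
        ≤ ∑' k : ℕ, r (k + (N + 1)) * (4 * π * remainderPoly (k + (N + 1))) := by
  choose χ hχ using exists_isAppCoreDatum_prolateFun
  exact lemma_49_i_core hN (fun n _ ↦ hχ n) hr hr' hs hρ

/-- **(computersafe) for THE series from an EVENTUAL majorant**: `∀ᶠ n, |λ(n)| ≤ r(n)` and
`Σ r(n)p(n) < ∞` give an index `N` beyond which the tail is controlled by `Σ_{n>N} r(n)·4πp(n)`
on `[1,2]` (`r(n) ≤ 13/200` eventually since `r(n)p(n) → 0`).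
[cite: ConnesConsani2021, App. F Lemma F.1 (i) (arXiv Lemma 49) eq. (computersafe), arXiv PDF p. 55 (chunk p0035:L78–L81)] -/
theorem lemma_49_i_prolateFun_of_eventually {r : ℕ → ℝ}
    (hr : ∀ᶠ n in atTop, |prolateEigen n| ≤ r n) (hs : Summable (fun n ↦ r n * remainderPoly n)) :
    ∃ N : ℕ, ∀ ρ ∈ Icc (1 : ℝ) 2,
      Summable (fun k : ℕ ↦ sonineQTerm (prolateFun (k + (N + 1))) (prolateEigen (k + (N + 1))) ρ) ∧
        |∑' k : ℕ, sonineQTerm (prolateFun (k + (N + 1))) (prolateEigen (k + (N + 1))) ρ|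
          ≤ ∑' k : ℕ, r (k + (N + 1)) * (4 * π * remainderPoly (k + (N + 1))) := by
  have hev : ∀ᶠ n in atTop, |prolateEigen n| ≤ r n ∧ (r n ≤ 13 / 200 ∧ 2 ≤ n) :=
    hr.and ((eventually_le_of_summable_mul_remainderPoly hs (by norm_num)).and
      (eventually_ge_atTop 2))
  obtain ⟨N, hN⟩ := eventually_atTop.1 hev
  refine ⟨N, fun ρ hρ ↦ ?_⟩
  exact lemma_49_i_prolateFun_of_majorant (hN N le_rfl).2.2 (fun n hn ↦ (hN n hn.le).1)
    (fun n hn ↦ (hN n hn.le).2.1) hs hρ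

/-- **(computersafe) for THE series from `Σ_n |λ(n)|n² < ∞`** (the decay input in its shape of
record, cf. `exists_contDiff_isArchDensity_of_summable`): an index `N` beyond which, for every
`ρ ∈ [1,2]`, the tail converges absolutely with `|Σ_{n>N} τ(n)T_n(ρ)| ≤ Σ_{n>N} |λ(n)|·4πp(n)`.
[cite: ConnesConsani2021, App. F Lemma F.1 (i) (arXiv Lemma 49) eq. (computersafe), arXiv PDF p. 55 (chunk p0035:L78–L81)] -/
theorem lemma_49_i_prolateFun_of_summable
    (hdec : Summable (fun n ↦ |prolateEigen n| * (n : ℝ) ^ 2)) :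
    ∃ N : ℕ, ∀ ρ ∈ Icc (1 : ℝ) 2,
      Summable (fun k : ℕ ↦ sonineQTerm (prolateFun (k + (N + 1))) (prolateEigen (k + (N + 1))) ρ) ∧
        |∑' k : ℕ, sonineQTerm (prolateFun (k + (N + 1))) (prolateEigen (k + (N + 1))) ρ|
          ≤ ∑' k : ℕ, |prolateEigen (k + (N + 1))| * (4 * π * remainderPoly (k + (N + 1))) :=
  lemma_49_i_prolateFun_of_eventually (Eventually.of_forall fun _ ↦ le_rfl)
    (summable_mul_remainderPoly_of_summable_mul_sq (fun _ ↦ abs_nonneg _) hdec)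

/-- **(computersafe) for THE series from [Osipov 2013, Thm 33] (the decay input of record, PROVED in
print)**: there is an index `N` such that for every `ρ ∈ [1,2]` the tail `Σ_{n>N} τ(n)T_n(ρ)`
converges absolutely with `|Σ_{n>N} τ(n)T_n(ρ)| ≤ Σ_{n>N} r_Os(n)·4πp(n)`, `r_Os = osipovMajorant`
(geometric).  HONEST CAVEAT: `N` is not the printed `10` and the printed number `2.366·10⁻¹²` is not
asserted here. [cite: ConnesConsani2021, App. F Lemma F.1 (i) (arXiv Lemma 49) eq. (computersafe), arXiv PDF p. 55; Osipov2013, Thm. 33] -/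
theorem lemma_49_i_prolateFun_of_osipov (h : Osipov2013_thm_33) :
    ∃ N : ℕ, ∀ ρ ∈ Icc (1 : ℝ) 2,
      Summable (fun k : ℕ ↦ sonineQTerm (prolateFun (k + (N + 1))) (prolateEigen (k + (N + 1))) ρ) ∧
        |∑' k : ℕ, sonineQTerm (prolateFun (k + (N + 1))) (prolateEigen (k + (N + 1))) ρ|
          ≤ ∑' k : ℕ, osipovMajorant (k + (N + 1)) * (4 * π * remainderPoly (k + (N + 1))) :=
  lemma_49_i_prolateFun_of_eventually (eventually_abs_prolateEigen_le_osipovMajorant h)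
    summable_osipovMajorant_mul_remainderPoly

/-! ## Unconditional forms (the decay input is a tree theorem: `summable_abs_prolateEigen_mul_sq`) -/

/-- **App. F Lemma F.1 (i) (computersafe) for THE prolate sequence — UNCONDITIONAL, qualitative
form (PROVED, no hypothesis)**: there is an index `N` such that for every `ρ ∈ [1,2]` the tail
`Σ_{n>N} τ(n)T_n(ρ)` converges absolutely and `|Σ_{n>N} τ(n)T_n(ρ)| ≤ Σ_{n>N} |λ(n)|·4πp(n)` — the decay
input `Σ |λ(n)|n² < ∞` being the tree theorem `summable_abs_prolateEigen_mul_sq`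
(`ProlateEigenvaluePolynomialDecay.lean`, Green symmetry of the prolate operator against the cosine
kernel).  The printed quantitative form (`N = 2`, majorant `a(n)`, number `2.366·10⁻¹²` at `N = 10`)
remains the landed statement modulo (rapid-decay).
[cite: ConnesConsani2021, App. F Lemma F.1 (i) (arXiv Lemma 49) eq. (computersafe), arXiv PDF p. 55 (chunk p0035:L78–L81)] -/
theorem lemma_49_i_prolateFun_unconditional :
    ∃ N : ℕ, ∀ ρ ∈ Icc (1 : ℝ) 2,
      Summable (fun k : ℕ ↦ sonineQTerm (prolateFun (k + (N + 1))) (prolateEigen (k + (N + 1))) ρ) ∧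
        |∑' k : ℕ, sonineQTerm (prolateFun (k + (N + 1))) (prolateEigen (k + (N + 1))) ρ|
          ≤ ∑' k : ℕ, |prolateEigen (k + (N + 1))| * (4 * π * remainderPoly (k + (N + 1))) :=
  lemma_49_i_prolateFun_of_summable summable_abs_prolateEigen_mul_sq

/-- **The series (98)/(sonineQ) `Σ_n τ(n)T_n(ρ)` converges absolutely for every `ρ ∈ [1,2]` —
UNCONDITIONAL** ("We refer to Appendix F for the proof of the convergence of the infinite series",
proof of Prop. 5.3). [cite: ConnesConsani2021, Prop. 5.3 proof §5 p. 32 (arXiv item Prop. 30, chunk p0020:L66–L67); App. F Lemma F.1 (i)] -/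
theorem summable_sonineQTerm_prolateFun {ρ : ℝ} (hρ : ρ ∈ Icc (1 : ℝ) 2) :
    Summable (fun n : ℕ ↦ sonineQTerm (prolateFun n) (prolateEigen n) ρ) := by
  obtain ⟨N, hN⟩ := lemma_49_i_prolateFun_unconditional
  exact (summable_nat_add_iff (f := fun n ↦ sonineQTerm (prolateFun n) (prolateEigen n) ρ)
    (N + 1)).1 (hN ρ hρ).1

end Literature.NumberTheory.ConnesConsani2021

end
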